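import Mathlib
import Summits.CriticalPhenomena.PercolationContinuityZ3.Theorems.PercNearOneGluingNoHeavyLowerTailOrientedAntipodalHallOmegaSocket

/-!
# Conjecture Ω is false: a five-point counterexample to full independence with the one-sided enlargement

Helper file for crux `stmt-CriticalPhenomena-4575` (`NoHeavyLowerTail`, route `PercNearOneGluingNoHeavy`),
new-inequality factory seat `prim-ineq-gen-3` (gen 14).  Everything here is PROVED (by `decide` and
elementary linear algebra); it is a NEGATIVE result about the seat's own Conjecture Ω (memo
`CONJECTURE-OMEGA.md`, HOME `run/shared/lean/prim/prim-ineq-gen-3/`), i.e. about the hypothesis of the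
Ω-socket `OrientedAntipodalHall.card_le_card_goods_above_of_indep` (file `…OmegaSocket`).

**The counterexample.**  Ground set `S = {0,1,2,3,4}`, four petals, sunflower labeling
`f = cexLab : Finset (Fin 5) → Lab 4` with up-sets
`A₀ = ↑{02, 12}`, `A₁ = ↑{13}`, `A₂ = ↑{23, 24}`, `A₃ = ↑{04}` and top part
`𝒯 = ↑{023, 123, 024, 124, 0134}` (= every pairwise intersection `A_p ∩ A_q`); `f` is monotone
(`cexLab_monotone`).  The four antipodal bads
`D = {134, 24, 014, 12}` have types `(f X, f (S \ X)) = (C₁,C₀), (C₂,C₁), (C₃,C₂), (C₀,C₃)` — the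
directed 4-cycle `1 → 0 → 3 → 2 → 1`, an OPPOSITE-FREE type set (`cexD_bad`, `cexD_oppositeFree`).
With `G = {F ⊆ S : f F = B, f (S \ F) ≠ B, F ⊆ S \ X for some X ∈ D}` (nine faces) and its pseudo-class
`Ψ = {F ∈ G : f (S \ F) ≠ A} = {01, 34}`, the plain vectors of the complemented members
`02, 013, 23, 034` and of the two pseudo-sets satisfy
`χ_{01} − χ_{02} − χ_{013} + χ_{23} − χ_{34} + χ_{034} = 0` in `ℚ^G`
(`cex_sum_eq_zero`), so they are linearly DEPENDENT (`not_linearIndependent_cex`): the hypothesis of the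
Ω-socket fails although the types are opposite-free (`omega_hypothesis_fails`).  The Hall count itself
holds here (`#D = 4 ≤ 7` goods above `D`); an exhaustive check of all labelings on ≤ 5 points finds no
violation of Conjecture O_k, while every violation of Ω found has four petals and a directed 4-cycle of
types (memo FINDINGS-gen14, kit job j124520).  (prim-ineq-gen-3 gen 14, 2026-08-21.)
-/

namespace Summit.CriticalPhenomena.PercolationContinuityZ3.Theorems

namespace OrientedAntipodalHall

open Finset AntipodalStrongHarris AntipodalStrongHarris.Lab ThreeFamilyRank

/-- The label order of `Lab k` is decidable (it is a disjunction of equalities). -/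
instance Lab.decidableLE {k : ℕ} : DecidableRel (α := Lab k) (· ≤ ·) :=
  fun a b => decidable_of_iff (a = bot ∨ b = top ∨ a = b) (Lab.le_def a b).symm

namespace OmegaCounterexample

/-- The ground set `S = {0,1,2,3,4}`. -/
abbrev S5 : Finset (Fin 5) := Finset.univ

/-- The counterexample labeling: `A = ↑{023,123,024,124,0134}`, `C₀ = ↑{02,12} ∖ A`, `C₁ = ↑{13} ∖ A`,
`C₂ = ↑{23,24} ∖ A`, `C₃ = ↑{04} ∖ A`, `B` otherwise. -/
def cexLab (U : Finset (Fin 5)) : Lab 4 :=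
  if ({0, 2, 3} : Finset (Fin 5)) ⊆ U ∨ ({1, 2, 3} : Finset (Fin 5)) ⊆ U ∨ ({0, 2, 4} : Finset (Fin 5)) ⊆ U ∨
      ({1, 2, 4} : Finset (Fin 5)) ⊆ U ∨ ({0, 1, 3, 4} : Finset (Fin 5)) ⊆ U then top
  else if ({0, 2} : Finset (Fin 5)) ⊆ U ∨ ({1, 2} : Finset (Fin 5)) ⊆ U then petal 0
  else if ({1, 3} : Finset (Fin 5)) ⊆ U then petal 1
  else if ({2, 3} : Finset (Fin 5)) ⊆ U ∨ ({2, 4} : Finset (Fin 5)) ⊆ U then petal 2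
  else if ({0, 4} : Finset (Fin 5)) ⊆ U then petal 3
  else bot

/-- `cexLab` is a sunflower labeling (monotone for `B < Cᵢ < A`). -/
theorem cexLab_monotone : ∀ ⦃X Y : Finset (Fin 5)⦄, X ⊆ Y → cexLab X ≤ cexLab Y := by
  decide

/-- The four antipodal bads of the counterexample. -/
def cexD : Finset (Finset (Fin 5)) := { {1, 3, 4}, {2, 4}, {0, 1, 4}, {1, 2} }

/-- Every member of `cexD` is an antipodal bad: it and its complement carry petal labels. -/
theorem cexD_bad : ∀ X ∈ cexD, (∃ i, cexLab X = petal i) ∧ ∃ j, cexLab (S5 \ X) = petal j := by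
  decide

/-- The types of `cexD` are OPPOSITE-FREE (and no member has equal labels on itself and its complement):
the type digraph is the directed 4-cycle `1 → 0 → 3 → 2 → 1`. -/
theorem cexD_oppositeFree :
    ∀ X ∈ cexD, ∀ X' ∈ cexD, ¬ (cexLab X = cexLab (S5 \ X') ∧ cexLab X' = cexLab (S5 \ X)) := by
  decide

/-- The one-sided enlargement `G` of the co-goods above `cexD`, listed explicitly (nine faces: the `B`-sets
missing some bad of `cexD`; the tenth `B`-set `{1,4}` meets every bad). -/
def cexG : Finset (Finset (Fin 5)) :=
  { ∅, {0}, {1}, {0, 1}, {2}, {3}, {0, 3}, {4}, {3, 4} }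

/-- `G = {F ⊆ S : f F = B, f (S \ F) ≠ B, F ⊆ S \ X for some X ∈ D}` is `cexG`. -/
theorem filter_eq_cexG :
    {F ∈ S5.powerset | cexLab F = bot ∧ cexLab (S5 \ F) ≠ bot ∧ ∃ X ∈ cexD, F ⊆ S5 \ X} = cexG := by
  decide

/-- The pseudo-class `Ψ = {F ∈ G : f (S \ F) ≠ A}` is `{01, 34}`. -/
theorem filter_eq_cexPsi : {F ∈ cexG | cexLab (S5 \ F) ≠ top} = ({{0, 1}, {3, 4}} : Finset (Finset (Fin 5))) := by
  decide

/-- The six sets of the dependent family: complemented members `02, 013, 23, 034` and pseudo-sets `01, 34`. -/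
def cexFam : Fin 6 → Finset (Fin 5)
  | 0 => {0, 1}
  | 1 => {0, 2}
  | 2 => {0, 1, 3}
  | 3 => {2, 3}
  | 4 => {3, 4}
  | 5 => {0, 3, 4}

/-- The coefficients of the dependency. -/
def cexCoef : Fin 6 → ℚ
  | 0 => 1
  | 1 => -1
  | 2 => -1
  | 3 => 1
  | 4 => -1
  | 5 => 1

/-- `cexFam` is injective. -/
theorem cexFam_injective : Function.Injective cexFam := by
  intro i j h
  revert i j
  decide

/-- The family indexes exactly the complemented members of `cexD` together with the pseudo-class. -/
theorem cexFam_mem (i : Fin 6) :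
    cexFam i ∈ cexD.image (fun X => S5 \ X) ∪ ({{0, 1}, {3, 4}} : Finset (Finset (Fin 5))) := by
  revert i
  decide

/-- The integer identity behind the dependency: for every face `E ∈ G`,
`Σ_i c_i [E ⊆ U_i] = 0`. -/
theorem cex_sum_int (E : Finset (Fin 5)) (hE : E ∈ cexG) :
    (∑ i : Fin 6, if E ⊆ cexFam i then (match i with
      | 0 => (1 : ℤ) | 1 => -1 | 2 => -1 | 3 => 1 | 4 => -1 | 5 => 1) else 0) = 0 := by
  revert E
  decide

/-- The dependency `χ_{01} − χ_{02} − χ_{013} + χ_{23} − χ_{34} + χ_{034} = 0` in `ℚ^G`. -/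
theorem cex_sum_eq_zero : ∑ i : Fin 6, cexCoef i • chi cexG (cexFam i) = 0 := by
  funext E
  obtain ⟨E, hE⟩ := E
  have h := cex_sum_int E hE
  simp only [Finset.sum_apply, Pi.smul_apply, Pi.zero_apply, chi, smul_eq_mul, mul_ite, mul_one,
    mul_zero]
  have hcast : ∀ i : Fin 6, (cexCoef i) = ((match i with
      | 0 => (1 : ℤ) | 1 => -1 | 2 => -1 | 3 => 1 | 4 => -1 | 5 => 1 : ℤ) : ℚ) := by
    intro i; fin_cases i <;> simp [cexCoef]
  have : (∑ i : Fin 6, if E ⊆ cexFam i then cexCoef i else 0)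
      = ((∑ i : Fin 6, if E ⊆ cexFam i then (match i with
      | 0 => (1 : ℤ) | 1 => -1 | 2 => -1 | 3 => 1 | 4 => -1 | 5 => 1) else 0 : ℤ) : ℚ) := by
    push_cast
    refine Finset.sum_congr rfl fun i _ => ?_
    split_ifs <;> simp [hcast i]
  rw [this, h]
  simp

/-- The six plain vectors are linearly dependent in `ℚ^G`. -/
theorem not_linearIndependent_cex : ¬ LinearIndependent ℚ fun i : Fin 6 => chi cexG (cexFam i) := by
  rw [Fintype.not_linearIndependent_iff]
  exact ⟨cexCoef, cex_sum_eq_zero, 0, by simp [cexCoef]⟩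

/-- **Conjecture Ω fails.**  For the monotone labeling `cexLab` on five points and the family `cexD` of
antipodal bads with opposite-free types, the hypothesis of the Ω-socket
`card_le_card_goods_above_of_indep` (with `S = univ`) is false: the plain vectors of the complemented
members and of the pseudo-class are linearly dependent in `ℚ^G`. -/
theorem omega_hypothesis_fails (G Ψ : Finset (Finset (Fin 5)))
    (hG : G = {F ∈ S5.powerset | cexLab F = bot ∧ cexLab (S5 \ F) ≠ bot ∧ ∃ X ∈ cexD, F ⊆ S5 \ X})
    (hΨ : Ψ = {F ∈ G | cexLab (S5 \ F) ≠ top}) :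
    ¬ LinearIndependent ℚ fun U : ↥(cexD.image (fun X => S5 \ X) ∪ Ψ) => chi G (U : Finset (Fin 5)) := by
  have hG' : G = cexG := by rw [hG]; exact filter_eq_cexG
  subst hG'
  have hΨ' : Ψ = ({{0, 1}, {3, 4}} : Finset (Finset (Fin 5))) := by rw [hΨ]; exact filter_eq_cexPsi
  subst hΨ'
  intro hli
  let e : Fin 6 → ↥(cexD.image (fun X => S5 \ X) ∪ ({{0, 1}, {3, 4}} : Finset (Finset (Fin 5)))) :=
    fun i => ⟨cexFam i, cexFam_mem i⟩
  have he : Function.Injective e := by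
    intro i j h
    exact cexFam_injective (congrArg Subtype.val h)
  exact not_linearIndependent_cex (hli.comp e he)

end OmegaCounterexample


/-! ## A six-point counterexample with THREE petals (the cyclic triangle)

Conjecture Ω fails already for the cyclic triangle of types (gen 14, random thin search `thin_search.py`,
verified exactly by `cex_check2.py`): `S = {0,…,5}`, `A₀ = ↑{012, 14}`, `A₁ = ↑{23}`, `A₂ = ↑{34, 45}`,
`𝒯 = ↑{0123, 134, 234, 0125, 145}`; bads `D = {045, 0235, 012}` of types `(C₂,C₁), (C₁,C₀), (C₀,C₂)`
(the directed triangle `2 → 1 → 0 → 2`); complemented members `123, 14, 345`, pseudo-class `Ψ = {12, 13, 35}`,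
`G` = nine faces; dependency `χ_{12} + χ_{13} − χ_{123} − χ_{14} − χ_{35} + χ_{345} = 0`
(`OmegaCounterexample3.omega_hypothesis_fails₃`).  So Ω holds exactly in the acyclic case (where it is the
theorem `…OrientedAntipodalHallAcyclic`), as far as the smallest cycles are concerned; the oriented Hall COUNT
for the cyclic triangle is nevertheless a theorem (`card_le_card_goods_above_cyclic_holds`, gen 9). -/

namespace OmegaCounterexample3

/-- The ground set `S = {0,…,5}`. -/
abbrev S6 : Finset (Fin 6) := Finset.univ

/-- The three-petal counterexample labeling: `A = ↑{0123,134,234,0125,145}`, `C₀ = ↑{012,14} ∖ A`,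
`C₁ = ↑{23} ∖ A`, `C₂ = ↑{34,45} ∖ A`, `B` otherwise. -/
def cexLab₃ (U : Finset (Fin 6)) : Lab 3 :=
  if ({0, 1, 2, 3} : Finset (Fin 6)) ⊆ U ∨ ({1, 3, 4} : Finset (Fin 6)) ⊆ U ∨ ({2, 3, 4} : Finset (Fin 6)) ⊆ U ∨
      ({0, 1, 2, 5} : Finset (Fin 6)) ⊆ U ∨ ({1, 4, 5} : Finset (Fin 6)) ⊆ U then top
  else if ({0, 1, 2} : Finset (Fin 6)) ⊆ U ∨ ({1, 4} : Finset (Fin 6)) ⊆ U then petal 0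
  else if ({2, 3} : Finset (Fin 6)) ⊆ U then petal 1
  else if ({3, 4} : Finset (Fin 6)) ⊆ U ∨ ({4, 5} : Finset (Fin 6)) ⊆ U then petal 2
  else bot

set_option maxRecDepth 100000 in
/-- `cexLab₃` is a sunflower labeling (monotone for `B < Cᵢ < A`). -/
theorem cexLab₃_monotone : ∀ ⦃X Y : Finset (Fin 6)⦄, X ⊆ Y → cexLab₃ X ≤ cexLab₃ Y := by
  decide

/-- The three antipodal bads of the three-petal counterexample. -/
def cexD₃ : Finset (Finset (Fin 6)) := { {0, 4, 5}, {0, 2, 3, 5}, {0, 1, 2} }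

set_option maxRecDepth 100000 in
/-- Every member of `cexD₃` is an antipodal bad. -/
theorem cexD₃_bad : ∀ X ∈ cexD₃, (∃ i, cexLab₃ X = petal i) ∧ ∃ j, cexLab₃ (S6 \ X) = petal j := by
  decide

set_option maxRecDepth 100000 in
/-- The types of `cexD₃` are opposite-free (they form the directed triangle `2 → 1 → 0 → 2`). -/
theorem cexD₃_oppositeFree :
    ∀ X ∈ cexD₃, ∀ X' ∈ cexD₃, ¬ (cexLab₃ X = cexLab₃ (S6 \ X') ∧ cexLab₃ X' = cexLab₃ (S6 \ X)) := by
  decide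

/-- The one-sided enlargement `G` of the co-goods above `cexD₃` (nine faces). -/
def cexG₃ : Finset (Finset (Fin 6)) :=
  { ∅, {1}, {2}, {1, 2}, {3}, {1, 3}, {4}, {5}, {3, 5} }

set_option maxRecDepth 100000 in
/-- `G = {F ⊆ S : f F = B, f (S \ F) ≠ B, F ⊆ S \ X for some X ∈ D}` is `cexG₃`. -/
theorem filter_eq_cexG₃ :
    {F ∈ S6.powerset | cexLab₃ F = bot ∧ cexLab₃ (S6 \ F) ≠ bot ∧ ∃ X ∈ cexD₃, F ⊆ S6 \ X} = cexG₃ := by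
  decide

set_option maxRecDepth 100000 in
/-- The pseudo-class `Ψ = {F ∈ G : f (S \ F) ≠ A}` is `{12, 13, 35}`. -/
theorem filter_eq_cexPsi₃ :
    {F ∈ cexG₃ | cexLab₃ (S6 \ F) ≠ top} = ({{1, 2}, {1, 3}, {3, 5}} : Finset (Finset (Fin 6))) := by
  decide

/-- The six sets of the dependent family: complemented members `123, 14, 345` and pseudo-sets `12, 13, 35`. -/
def cexFam₃ : Fin 6 → Finset (Fin 6)
  | 0 => {1, 2}
  | 1 => {1, 3}
  | 2 => {1, 2, 3}
  | 3 => {1, 4}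
  | 4 => {3, 5}
  | 5 => {3, 4, 5}

/-- The coefficients of the dependency. -/
def cexCoef₃ : Fin 6 → ℚ
  | 0 => 1
  | 1 => 1
  | 2 => -1
  | 3 => -1
  | 4 => -1
  | 5 => 1

/-- `cexFam₃` is injective. -/
theorem cexFam₃_injective : Function.Injective cexFam₃ := by
  intro i j h
  revert i j
  decide

/-- The family indexes exactly the complemented members of `cexD₃` together with the pseudo-class. -/
theorem cexFam₃_mem (i : Fin 6) :
    cexFam₃ i ∈ cexD₃.image (fun X => S6 \ X) ∪ ({{1, 2}, {1, 3}, {3, 5}} : Finset (Finset (Fin 6))) := by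
  revert i
  decide

/-- The integer identity behind the dependency: for every face `E ∈ G`, `Σ_i c_i [E ⊆ U_i] = 0`. -/
theorem cex_sum_int₃ (E : Finset (Fin 6)) (hE : E ∈ cexG₃) :
    (∑ i : Fin 6, if E ⊆ cexFam₃ i then (match i with
      | 0 => (1 : ℤ) | 1 => 1 | 2 => -1 | 3 => -1 | 4 => -1 | 5 => 1) else 0) = 0 := by
  revert E
  decide

/-- The dependency `χ_{12} + χ_{13} − χ_{123} − χ_{14} − χ_{35} + χ_{345} = 0` in `ℚ^G`. -/
theorem cex_sum_eq_zero₃ : ∑ i : Fin 6, cexCoef₃ i • chi cexG₃ (cexFam₃ i) = 0 := by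
  funext E
  obtain ⟨E, hE⟩ := E
  have h := cex_sum_int₃ E hE
  simp only [Finset.sum_apply, Pi.smul_apply, Pi.zero_apply, chi, smul_eq_mul, mul_ite, mul_one,
    mul_zero]
  have hcast : ∀ i : Fin 6, (cexCoef₃ i) = ((match i with
      | 0 => (1 : ℤ) | 1 => 1 | 2 => -1 | 3 => -1 | 4 => -1 | 5 => 1 : ℤ) : ℚ) := by
    intro i; fin_cases i <;> simp [cexCoef₃]
  have : (∑ i : Fin 6, if E ⊆ cexFam₃ i then cexCoef₃ i else 0)
      = ((∑ i : Fin 6, if E ⊆ cexFam₃ i then (match i with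
      | 0 => (1 : ℤ) | 1 => 1 | 2 => -1 | 3 => -1 | 4 => -1 | 5 => 1) else 0 : ℤ) : ℚ) := by
    push_cast
    refine Finset.sum_congr rfl fun i _ => ?_
    split_ifs <;> simp [hcast i]
  rw [this, h]
  simp

/-- The six plain vectors are linearly dependent in `ℚ^G`. -/
theorem not_linearIndependent_cex₃ : ¬ LinearIndependent ℚ fun i : Fin 6 => chi cexG₃ (cexFam₃ i) := by
  rw [Fintype.not_linearIndependent_iff]
  exact ⟨cexCoef₃, cex_sum_eq_zero₃, 0, by simp [cexCoef₃]⟩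

/-- **Conjecture Ω fails with three petals.**  For the monotone labeling `cexLab₃` on six points and the
family `cexD₃` of antipodal bads whose types form the cyclic triangle, the hypothesis of the Ω-socket
`card_le_card_goods_above_of_indep` (with `S = univ`) is false. -/
theorem omega_hypothesis_fails₃ (G Ψ : Finset (Finset (Fin 6)))
    (hG : G = {F ∈ S6.powerset | cexLab₃ F = bot ∧ cexLab₃ (S6 \ F) ≠ bot ∧ ∃ X ∈ cexD₃, F ⊆ S6 \ X})
    (hΨ : Ψ = {F ∈ G | cexLab₃ (S6 \ F) ≠ top}) :
    ¬ LinearIndependent ℚ fun U : ↥(cexD₃.image (fun X => S6 \ X) ∪ Ψ) => chi G (U : Finset (Fin 6)) := by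
  have hG' : G = cexG₃ := by rw [hG]; exact filter_eq_cexG₃
  subst hG'
  have hΨ' : Ψ = ({{1, 2}, {1, 3}, {3, 5}} : Finset (Finset (Fin 6))) := by rw [hΨ]; exact filter_eq_cexPsi₃
  subst hΨ'
  intro hli
  let e : Fin 6 → ↥(cexD₃.image (fun X => S6 \ X) ∪ ({{1, 2}, {1, 3}, {3, 5}} : Finset (Finset (Fin 6)))) :=
    fun i => ⟨cexFam₃ i, cexFam₃_mem i⟩
  have he : Function.Injective e := by
    intro i j h
    exact cexFam₃_injective (congrArg Subtype.val h)
  exact not_linearIndependent_cex₃ (hli.comp e he)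

end OmegaCounterexample3

end OrientedAntipodalHall

end Summit.CriticalPhenomena.PercolationContinuityZ3.Theorems
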